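import Mathlib
import HarnessLib
import Summits.HubbardSuperconductivity.HubbardSuperconductivity.Theorems.KLProgrammeKLRegimeSplitPolarAngleDerivBounds
import Summits.HubbardSuperconductivity.HubbardSuperconductivity.Theorems.KLProgrammeKLRegimeSplitFermiPointLevelC4

/-!
# Route `KLProgramme`, crux K3 — ENGINE child `KLRegimeEngineV11` (stmt-HubbardSuperconductivity-19823), two-leg stubs: the
# G-EXTENSION SYMBOL `q ↦ ψ(ε(q))·g(θ(q))` (radial cutoff × angular profile) has EXPLICIT, VOLUME-FREE derivative bounds of every
# order, linear in the profile sizes: `‖Dⁿ‖ ≤ (n!)²·P·G·(4 + max 1 ((n−1)!/r))ⁿ`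

Cell gate-hubbard-kl, seat hubbard-kl-k3c3-p1 (g2; row «δμ-flow with `klAngularMean` constant piece»).  The two-leg G-objects of the
K3 bundle are built from an angular profile `f` (the local part `ν_n(K)` or its increments, read on the frame's Fermi curve) by the
G-extension `klFrameExtG L μ f = symInterp L (k ↦ mean f + χ_flat(k)·(f(θ(k)) − mean f))` (BundleV6 §1): the CONSTANT PIECE
`mean f = klAngularMean f` is carried exactly (the δμ-flow; every derivative kills it) and the mean-free part `g = f − mean f` is cut
off radially by `χ_flat(k) = ψ(ε(k))`, `ψ(u) = 1 − χ₂((u−μ)²/4R²)`, and read along the polar angle `θ`.  The lattice data are the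
samples `S ∘ latticeMomentum L` of the continuum SYMBOL `S(p) = mean f + ψ(ε(p̄))·g(θ(p̄))`; every certification route for the
sizes (E3a-G)/(E3a-MS) of the G-pieces — the interpolant compared pointwise with `S` (symInterp toolkit part 5, p2 g6), p2's Δ-INTERP
repair (R-I) in which `S` itself is the frame (`klFrameExtFn`), or a damped interpolant — needs the momentum derivatives of `S` in
terms of the angular derivatives of `f`.  This file proves them, for ABSTRACT one-variable profiles (`ψ` radial with `‖Dⁱψ‖ ≤ P`
and support `|u − μ| ≤ δ`; `g` angular, `2π`-periodic, `‖Dⁱg‖ ≤ G`), on `Momentum = EuclideanSpace ℝ (Fin 2)`: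

* §1 `norm_iteratedFDeriv_sqDispersion_ofLp_le` (`‖Dⁱε‖ ≤ 4` on `Momentum`, from p1b's sup-norm version) and
  **`norm_iteratedFDeriv_profile_sqDispersion_le`**: `‖Dⁿ(ψ ∘ ε)(q)‖ ≤ n!·P·4ⁿ`;
* §2 `contDiffAt_comp_polarAngle_ofLp` and **`norm_iteratedFDeriv_symbol_le`**: for `‖q‖ ≥ r > 0`,
  `‖Dⁿ(ψ(ε)·g(θ))(q)‖ ≤ (n!)²·P·G·(4 + max 1 ((n−1)!/r))ⁿ` — Leibniz on the open chart `{q ≠ 0}` (`norm_iteratedFDerivWithin_mul_le`),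
  the angular factor by `norm_iteratedFDeriv_comp_polarAngle_le_of_le_norm` (`…SplitPolarAngleDerivBounds`: `‖Dˡθ‖ = (l−1)!/‖q‖ˡ`),
  the binomial theorem;
* §3 `le_norm_of_sqDispersion_ge` (the tube is away from the origin: `ε(q) ≥ −4 + r² ⇒ ‖q‖ ≥ r`),
  `iteratedFDeriv_symbol_eq_zero_of_lt` (outside the radial support every derivative vanishes) and the GLOBAL form
  **`norm_iteratedFDeriv_symbol_le_of_support`**: with `ψ = 0` off `|u − μ| < δ` and `r² ≤ μ − δ + 4`, the bound of §2 holds at EVERY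
  `q` (for the flat cutoff on `klWindowC`: `δ = 1/10`, `r² = 2.85`).

The constant piece: the full symbol is `m + ψ(ε)·g(θ)` with `m = klAngularMean f`, so `‖D⁰‖ ≤ |m| + P·G` and the bound above for
`n ≥ 1` verbatim.  Centring (`p ↦ p̄`, a translation near every point of the tube) and `2π`-periodicity, needed to identify
`S ∘ latticeMomentum L` with the `klFrameExtG` data at ALL lattice momenta, are bookkeeping on top of this file (sequel).  Proofs only
(no definitions); nothing is asserted about the model.  References: BGM 2006 [arXiv:cond-mat/0507686] §2.3–2.4 ((2.36), (2.40): the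
sizes of the local part and their angular derivatives); FST, CPAM 53 (2000) 1350 (counterterms as functions on the Fermi surface
extended along normals); HOME/p2-g6/DELTA-INTERP.md (why the symbol, not its interpolant, carries the top-order sizes).
-/

noncomputable section

namespace Summit.HubbardSuperconductivity.HubbardSuperconductivity.Theorems.KLRegimeSplit

set_option linter.dupNamespace false -- summit = problem name (single-conjunct summit), D-0017

open Real Finset Filter Literature.MathematicalPhysics.QuantumLattice Literature.Analysis.SpecialFunctions
open Summit.HubbardSuperconductivity.HubbardSuperconductivity.Theorems.PerturbedFermiCurve
open scoped Topology

/-! ## §1 The radial factor `q ↦ ψ(ε(q))`: `‖Dⁿ(ψ ∘ ε)(q)‖ ≤ n!·P·4ⁿ` -/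

/-- `ofLp : Momentum → (Fin 2 → ℝ)` as a continuous linear map of norm `≤ 1` (Euclidean norm dominates the sup norm). -/
theorem exists_ofLpCLM :
    ∃ Λ : Momentum →L[ℝ] (Fin 2 → ℝ), (∀ q : Momentum, Λ q = WithLp.ofLp q) ∧ ‖Λ‖ ≤ 1 := by
  refine ⟨(PiLp.continuousLinearEquiv 2 ℝ (fun _ : Fin 2 => ℝ) : Momentum →L[ℝ] (Fin 2 → ℝ)), fun q => rfl,
    ContinuousLinearMap.opNorm_le_bound _ zero_le_one fun q => ?_⟩
  rw [one_mul]
  exact (pi_norm_le_iff_of_nonneg (norm_nonneg q)).mpr fun i => PiLp.norm_apply_le q i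

/-- The free band read on `Momentum` is smooth. -/
theorem contDiff_sqDispersion_ofLp {N : WithTop ℕ∞} : ContDiff ℝ N fun q : Momentum => sqDispersion (WithLp.ofLp q) := by
  obtain ⟨Λ, hΛ, -⟩ := exists_ofLpCLM
  have : (fun q : Momentum => sqDispersion (WithLp.ofLp q)) = sqDispersion ∘ Λ := by funext q; simp [hΛ]
  rw [this]
  exact contDiff_sqDispersion.comp Λ.contDiff

/-- **All derivatives of the free band on `Momentum` are bounded by `4`.** -/
theorem norm_iteratedFDeriv_sqDispersion_ofLp_le (i : ℕ) (q : Momentum) :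
    ‖iteratedFDeriv ℝ i (fun q : Momentum => sqDispersion (WithLp.ofLp q)) q‖ ≤ 4 := by
  obtain ⟨Λ, hΛ, hΛn⟩ := exists_ofLpCLM
  have : (fun q : Momentum => sqDispersion (WithLp.ofLp q)) = sqDispersion ∘ Λ := by funext q; simp [hΛ]
  rw [this, ContinuousLinearMap.iteratedFDeriv_comp_right Λ contDiff_sqDispersion q (i := i) le_top]
  refine (ContinuousMultilinearMap.norm_compContinuousLinearMap_le _ _).trans ?_
  rw [Finset.prod_const, Finset.card_univ, Fintype.card_fin]
  calc ‖iteratedFDeriv ℝ i sqDispersion (Λ q)‖ * ‖Λ‖ ^ i ≤ 4 * 1 ^ i :=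
        mul_le_mul (norm_iteratedFDeriv_sqDispersion_le i _) (pow_le_pow_left₀ (norm_nonneg _) hΛn i) (by positivity)
          (by norm_num)
    _ = 4 := by rw [one_pow, mul_one]

/-- **The radial factor**: for a one-variable profile `ψ` with `‖Dⁱψ‖ ≤ P` (`i ≤ n`), `‖Dⁿ (q ↦ ψ(ε(q)))(q)‖ ≤ n!·P·4ⁿ`. -/
theorem norm_iteratedFDeriv_profile_sqDispersion_le {ψ : ℝ → ℝ} {N : WithTop ℕ∞} (hψ : ContDiff ℝ N ψ) {n : ℕ}
    (hn : (n : WithTop ℕ∞) ≤ N) {P : ℝ} (hP : ∀ i ≤ n, ∀ u : ℝ, ‖iteratedFDeriv ℝ i ψ u‖ ≤ P) (q : Momentum) :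
    ‖iteratedFDeriv ℝ n (fun q : Momentum => ψ (sqDispersion (WithLp.ofLp q))) q‖ ≤ n.factorial * P * 4 ^ n := by
  have h := norm_iteratedFDeriv_comp_le (g := ψ) (f := fun q : Momentum => sqDispersion (WithLp.ofLp q)) hψ
    contDiff_sqDispersion_ofLp hn q (C := P) (D := 4) (fun i hi => hP i hi _) fun i hi1 _ =>
      (norm_iteratedFDeriv_sqDispersion_ofLp_le i q).trans (by
        calc (4 : ℝ) = 4 ^ 1 := (pow_one _).symm
          _ ≤ 4 ^ i := pow_le_pow_right₀ (by norm_num) hi1)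
  exact h

/-! ## §2 The symbol `q ↦ ψ(ε(q))·g(θ(q))` off the origin: Leibniz + the angular chain rule -/

section Symbol

variable {ψ g : ℝ → ℝ} {N : WithTop ℕ∞}

/-- The angular factor `q ↦ g(polarAngle q)` is `C^N` off the origin for `2π`-periodic `C^N` `g`. -/
theorem contDiffAt_comp_polarAngle_ofLp (hg : ContDiff ℝ N g) (hper : Function.Periodic g (2 * Real.pi)) {q : Momentum}
    (hq : q ≠ 0) : ContDiffAt ℝ N (fun q : Momentum => g (polarAngle (WithLp.ofLp q))) q := by
  obtain ⟨Λ, hΛ, -⟩ := exists_ofLpCLM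
  have hz : momToComplex (WithLp.ofLp q) ≠ 0 := by
    intro h
    apply hq
    have h' := (momToComplex_eq_zero_iff _).1 h
    exact (WithLp.ofLp_eq_zero (p := 2)).mp h'
  have hfun : (fun q : Momentum => g (polarAngle (WithLp.ofLp q))) = (fun w => g (Complex.arg w)) ∘ fun q : Momentum =>
      momToComplex (Λ q) := by
    funext q'; simp [polarAngle, hΛ]
  rw [hfun]
  refine ContDiffAt.comp q ?_ (contDiff_momToComplex.comp Λ.contDiff).contDiffAt
  rw [hΛ]
  exact hg.contDiffAt_comp_arg hper hz

/-- **THE G-EXTENSION SYMBOL OFF THE ORIGIN — explicit bounds.**  For one-variable profiles `ψ` (radial cutoff, `‖Dⁱψ‖ ≤ P`) and `g`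
(`2π`-periodic angular profile, e.g. `f − mean f`, `‖Dⁱg‖ ≤ G`), `i ≤ n`, and a momentum with `‖q‖ ≥ r > 0`:
`‖Dⁿ (q ↦ ψ(ε(q))·g(θ(q)))(q)‖ ≤ (n!)²·P·G·(4 + max 1 ((n−1)!/r))ⁿ`
(Leibniz; the radial factor by §1; the angular factor by `norm_iteratedFDeriv_comp_polarAngle_le_of_le_norm`). -/
theorem norm_iteratedFDeriv_symbol_le (hψ : ContDiff ℝ N ψ) (hg : ContDiff ℝ N g) (hper : Function.Periodic g (2 * Real.pi))
    {n : ℕ} (hn : (n : WithTop ℕ∞) ≤ N) {P G r : ℝ} (hP : ∀ i ≤ n, ∀ u : ℝ, ‖iteratedFDeriv ℝ i ψ u‖ ≤ P)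
    (hG : ∀ i ≤ n, ∀ t : ℝ, ‖iteratedFDeriv ℝ i g t‖ ≤ G) (hr : 0 < r) {q : Momentum} (hrq : r ≤ ‖q‖) :
    ‖iteratedFDeriv ℝ n (fun q : Momentum => ψ (sqDispersion (WithLp.ofLp q)) * g (polarAngle (WithLp.ofLp q))) q‖ ≤
      (n.factorial : ℝ) ^ 2 * P * G * (4 + max 1 (((n - 1).factorial : ℝ) / r)) ^ n := by
  have hq : q ≠ 0 := by
    intro h; rw [h, norm_zero] at hrq; exact absurd hrq (not_le.mpr hr)
  have hP0 : 0 ≤ P := le_trans (norm_nonneg _) (hP 0 (Nat.zero_le _) 0)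
  have hG0 : 0 ≤ G := le_trans (norm_nonneg _) (hG 0 (Nat.zero_le _) 0)
  -- the open chart `{q ≠ 0}`
  set s : Set Momentum := {q | q ≠ 0} with hs
  have hso : IsOpen s := isOpen_ne
  have hqs : q ∈ s := hq
  set A : Momentum → ℝ := fun q => ψ (sqDispersion (WithLp.ofLp q)) with hA
  set B : Momentum → ℝ := fun q => g (polarAngle (WithLp.ofLp q)) with hB
  have hAc : ContDiffOn ℝ N A s := (hψ.comp contDiff_sqDispersion_ofLp).contDiffOn
  have hBc : ContDiffOn ℝ N B s := fun q' hq' => (contDiffAt_comp_polarAngle_ofLp hg hper hq').contDiffWithinAt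
  -- Leibniz on the chart, then back to unrestricted derivatives
  have hLeib := norm_iteratedFDerivWithin_mul_le hAc hBc hso.uniqueDiffOn hqs hn
  rw [iteratedFDerivWithin_of_isOpen n hso hqs] at hLeib
  refine hLeib.trans ?_
  -- bound every term
  set K : ℝ := max 1 (((n - 1).factorial : ℝ) / r) with hK
  have hK1 : 1 ≤ K := le_max_left _ _
  have hnf : (1 : ℝ) ≤ n.factorial := by exact_mod_cast Nat.one_le_iff_ne_zero.mpr (Nat.factorial_ne_zero n)
  have hterm : ∀ i ∈ Finset.range (n + 1),
      (n.choose i : ℝ) * ‖iteratedFDerivWithin ℝ i A s q‖ * ‖iteratedFDerivWithin ℝ (n - i) B s q‖ ≤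
        (n.choose i : ℝ) * ((n.factorial : ℝ) * P * 4 ^ i) * ((n.factorial : ℝ) * G * K ^ (n - i)) := by
    intro i hi
    have hin : i ≤ n := Nat.lt_succ_iff.mp (Finset.mem_range.mp hi)
    rw [iteratedFDerivWithin_of_isOpen i hso hqs, iteratedFDerivWithin_of_isOpen (n - i) hso hqs]
    have hAi : ‖iteratedFDeriv ℝ i A q‖ ≤ (n.factorial : ℝ) * P * 4 ^ i := by
      have h := norm_iteratedFDeriv_profile_sqDispersion_le hψ ((WithTop.coe_le_coe.mpr (by exact_mod_cast hin)).trans hn)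
        (P := P) (fun j hj u => hP j (hj.trans hin) u) q
      refine h.trans ?_
      have : (i.factorial : ℝ) ≤ n.factorial := by exact_mod_cast Nat.factorial_le hin
      gcongr
    have hBi : ‖iteratedFDeriv ℝ (n - i) B q‖ ≤ (n.factorial : ℝ) * G * K ^ (n - i) := by
      rcases Nat.eq_zero_or_pos (n - i) with h0 | hpos
      · rw [h0, iteratedFDeriv_zero_eq_comp, Function.comp_apply, LinearIsometryEquiv.norm_map, pow_zero, mul_one]
        have := hG 0 (Nat.zero_le _) (polarAngle (WithLp.ofLp q))
        rw [iteratedFDeriv_zero_eq_comp, Function.comp_apply, LinearIsometryEquiv.norm_map] at this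
        calc ‖B q‖ = ‖g (polarAngle (WithLp.ofLp q))‖ := rfl
          _ ≤ G := this
          _ = 1 * G := (one_mul _).symm
          _ ≤ (n.factorial : ℝ) * G := mul_le_mul_of_nonneg_right hnf hG0
      · have hle : ((n - i : ℕ) : WithTop ℕ∞) ≤ N := (WithTop.coe_le_coe.mpr (by exact_mod_cast Nat.sub_le n i)).trans hn
        have h := norm_iteratedFDeriv_comp_polarAngle_le_of_le_norm hg hper hr hrq hle (G := G)
          (fun j hj t => hG j (hj.trans (Nat.sub_le n i)) t)
        refine h.trans ?_
        have hfac : ((n - i).factorial : ℝ) ≤ n.factorial := by exact_mod_cast Nat.factorial_le (Nat.sub_le n i)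
        have hΘ : ((n - i - 1).factorial : ℝ) / r ≤ K := by
          refine le_trans ?_ (le_max_right _ _)
          exact div_le_div_of_nonneg_right (by exact_mod_cast Nat.factorial_le (by omega)) hr.le
        have hΘ0 : 0 ≤ ((n - i - 1).factorial : ℝ) / r := by positivity
        exact mul_le_mul (mul_le_mul_of_nonneg_right hfac hG0) (pow_le_pow_left₀ hΘ0 hΘ _) (by positivity) (by positivity)
    have hc0 : (0 : ℝ) ≤ (n.choose i : ℝ) := Nat.cast_nonneg _
    exact mul_le_mul (mul_le_mul_of_nonneg_left hAi hc0) hBi (norm_nonneg _) (by positivity)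
  refine (Finset.sum_le_sum hterm).trans (le_of_eq ?_)
  -- the binomial theorem: `Σ C(n,i) 4^i K^{n-i} = (4 + K)^n`
  have hbin : ∑ i ∈ Finset.range (n + 1), (n.choose i : ℝ) * 4 ^ i * K ^ (n - i) = (4 + K) ^ n := by
    rw [add_pow]
    refine Finset.sum_congr rfl fun i _ => ?_
    ring
  rw [← hbin, Finset.mul_sum]
  refine Finset.sum_congr rfl fun i _ => ?_
  ring

end Symbol

/-! ## §3 The tube geometry and the GLOBAL bound -/

/-- **Momenta in the tube are away from the origin**: `ε(q) ≥ −4 + r²` forces `‖q‖ ≥ r` (`cos x ≥ 1 − x²/2`). -/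
theorem le_norm_of_sqDispersion_ge {r : ℝ} (hr : 0 ≤ r) {q : Momentum} (h : -4 + r ^ 2 ≤ sqDispersion (WithLp.ofLp q)) :
    r ≤ ‖q‖ := by
  have h1 := sqDispersion_le_norm_sq (WithLp.ofLp q)
  have hnorm : ‖momToComplex (WithLp.ofLp q)‖ ^ 2 = ‖q‖ ^ 2 := by
    rw [Complex.sq_norm, Complex.normSq_apply, momToComplex_re, momToComplex_im, EuclideanSpace.norm_sq_eq, Fin.sum_univ_two,
      Real.norm_eq_abs, Real.norm_eq_abs, sq_abs, sq_abs]
    ring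
  rw [hnorm] at h1
  have hsq : r ^ 2 ≤ ‖q‖ ^ 2 := by linarith
  exact (pow_le_pow_iff_left₀ hr (norm_nonneg q) two_ne_zero).mp hsq

/-- **Outside the support of the radial profile every derivative of the symbol vanishes**: if `ψ(u) = 0` for `|u − μ| ≥ δ` and
`|ε(q) − μ| > δ`, then `Dⁿ (ψ(ε)·g(θ))(q) = 0`. -/
theorem iteratedFDeriv_symbol_eq_zero_of_lt {ψ g : ℝ → ℝ} {μ δ : ℝ} (hψ0 : ∀ u, δ ≤ |u - μ| → ψ u = 0) {q : Momentum}
    (hq : δ < |sqDispersion (WithLp.ofLp q) - μ|) (n : ℕ) :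
    iteratedFDeriv ℝ n (fun q : Momentum => ψ (sqDispersion (WithLp.ofLp q)) * g (polarAngle (WithLp.ofLp q))) q = 0 := by
  have hopen : IsOpen {q' : Momentum | δ < |sqDispersion (WithLp.ofLp q') - μ|} :=
    isOpen_lt continuous_const ((contDiff_sqDispersion_ofLp (N := 0)).continuous.sub continuous_const).abs
  have hev : (fun q : Momentum => ψ (sqDispersion (WithLp.ofLp q)) * g (polarAngle (WithLp.ofLp q))) =ᶠ[𝓝 q]
      fun _ => (0 : ℝ) := by
    filter_upwards [hopen.mem_nhds hq] with q' hq'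
    rw [hψ0 _ hq'.le, zero_mul]
  rw [(hev.iteratedFDeriv ℝ n).eq_of_nhds, iteratedFDeriv_fun_zero]
  rfl

section Global

variable {ψ g : ℝ → ℝ} {N : WithTop ℕ∞}

/-- **THE G-EXTENSION SYMBOL — GLOBAL EXPLICIT BOUNDS.**  Let `ψ` be a radial profile supported in `|u − μ| ≤ δ`
(`ψ(u) = 0` for `|u − μ| ≥ δ`; e.g. the flat cutoff `1 − χ₂((u−μ)²/4R²)`, `δ = 2R = 1/10`) with `‖Dⁱψ‖ ≤ P`, let `g` be a `2π`-periodic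
angular profile with `‖Dⁱg‖ ≤ G` (`i ≤ n`; e.g. `f − mean f`), and let the window satisfy `r² ≤ μ − δ + 4` with `r > 0` (on `klWindowC`
with `δ = 1/10`: `r² = 2.85`).  Then at EVERY momentum
`‖Dⁿ (q ↦ ψ(ε(q))·g(θ(q)))(q)‖ ≤ (n!)²·P·G·(4 + max 1 ((n−1)!/r))ⁿ` — volume-free, scale-free, linear in the profile sizes. -/
theorem norm_iteratedFDeriv_symbol_le_of_support (hψ : ContDiff ℝ N ψ) (hg : ContDiff ℝ N g)
    (hper : Function.Periodic g (2 * Real.pi)) {n : ℕ} (hn : (n : WithTop ℕ∞) ≤ N) {P G r μ δ : ℝ}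
    (hP : ∀ i ≤ n, ∀ u : ℝ, ‖iteratedFDeriv ℝ i ψ u‖ ≤ P) (hG : ∀ i ≤ n, ∀ t : ℝ, ‖iteratedFDeriv ℝ i g t‖ ≤ G)
    (hψ0 : ∀ u, δ ≤ |u - μ| → ψ u = 0) (hr : 0 < r) (hwin : r ^ 2 ≤ μ - δ + 4) (q : Momentum) :
    ‖iteratedFDeriv ℝ n (fun q : Momentum => ψ (sqDispersion (WithLp.ofLp q)) * g (polarAngle (WithLp.ofLp q))) q‖ ≤
      (n.factorial : ℝ) ^ 2 * P * G * (4 + max 1 (((n - 1).factorial : ℝ) / r)) ^ n := by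
  by_cases hq : δ < |sqDispersion (WithLp.ofLp q) - μ|
  · rw [iteratedFDeriv_symbol_eq_zero_of_lt hψ0 hq n, norm_zero]
    have hP0 : 0 ≤ P := le_trans (norm_nonneg _) (hP 0 (Nat.zero_le _) 0)
    have hG0 : 0 ≤ G := le_trans (norm_nonneg _) (hG 0 (Nat.zero_le _) 0)
    have hK : 0 ≤ 4 + max 1 (((n - 1).factorial : ℝ) / r) := by positivity
    positivity
  · have hε : -4 + r ^ 2 ≤ sqDispersion (WithLp.ofLp q) := by
      have := abs_le.mp (not_lt.mp hq)
      linarith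
    exact norm_iteratedFDeriv_symbol_le hψ hg hper hn hP hG hr (le_norm_of_sqDispersion_ge hr.le hε)

end Global


end Summit.HubbardSuperconductivity.HubbardSuperconductivity.Theorems.KLRegimeSplit

end
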